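import Literature.AlgebraicGeometry.HodgeTheory.DiagonalTorusMonodromy
import Literature.AlgebraicGeometry.HodgeTheory.MonomialSupportedHypersurfaceInvariantCycles
import Literature.AlgebraicGeometry.HodgeTheory.FermatOddDegreeRestriction
import Literature.AlgebraicGeometry.HodgeTheory.FermatInvariantClassesAmbient
import Literature.AlgebraicGeometry.Motives.MonomialLinearSystemIncidence
import HarnessLib

/-!
# Odd-dimensional monodromy of a base-point-free monomial family has no invariants — WITHOUT the global invariant
# cycle theorem

Family `hodge`, layer `Literature/AlgebraicGeometry/HodgeTheory`; theorems only (no definition, no named fact).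
Written by the prover seat `hodge-nonav-19716-p2` (g6) for crux K1-B `VeryGeneralSignCommutatorsInHg`
(stmt-HodgeConjecture-19716), third file after `DiagonalTorusFamily`, `DiagonalTorusMonodromy`.

For a base-point-free set `M` of degree-`d` monomials in `x₀, …, x_{n+1}` (`xᵢᵈ ∈ M` for all `i`) with `n = 2p + 1`
ODD, let `π_M : 𝒴_M → S_M` be the family of smooth `M`-supported hypersurfaces and `Γ_t ⊆ GL(Hⁿ(Y_t; ℚ))` its
rational monodromy group at `t ∈ S_M(ℂ)`.

**Theorem** (`familyM_ratInvariant_eq_zero_of_fermat`). Every `Γ_t`-invariant class of the middle cohomology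
`Hⁿ(Y_t; ℚ)` is zero — unconditionally.

The tree's `familyM_ratInvariant_eq_zero_of_odd` (`MonomialSupportedHypersurfaceNoInvariants`) proves this (for
every odd degree `k`) GRANTED Deligne's global invariant cycle theorem (`deligne_globalInvariantCycles`, Hodge II
4.1.1 / Voisin II 4.24). Here instead: (1) `S_M(ℂ)` is path connected (`pathConnectedSpace_complexPoints_baseM`),
so invariants at `t` transport to invariants at the Fermat point `t₀ = [Σ xᵢᵈ]`
(`forall_apply_eq_of_isRatTransport`); (2) by the torus trick (`DiagonalTorus.diagonalAut_conj_mem_ratMonodromyGroup_familyM`)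
every diagonal symmetry `a ∈ μ_d^{n+2}` of the Fermat hypersurface acts on `Hⁿ(Y_{t₀}; ℚ)` as a monodromy
transformation, so an invariant class is `μ_d^{n+2}`-invariant; (3) its complexification lies in the eigenspace `V(0)`
of the trivial character, which vanishes in odd degree (`fermatEigenspace_eq_bot_odd_of_apply_eq_zero`, Shioda 1979
§1: `Hⁿ(Xⁿ_d) = ⊕_{α ∈ 𝔄} V(α)`, all `αᵢ ≠ 0`).

The case `n = 3`, `M = {ι-even monomials}`, `d` even, is the input `stub_signNoInvariants` of crux K1-B of the route
SignSymmetricPowers (Hodge conjecture cell), which thereby no longer depends on Voisin II Prop. 4.23.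

§4 (appended): the EVEN-dimensional companion `familyM_ofRatClass_ratInvariant_mem_range_of_fermat_even` — middle-degree
invariants of `H²ʳ(Y_t; ℚ)` are restrictions of ambient classes (`V(0) ⊆ ι^* H²ʳ(ℙ²ʳ⁺¹)`,
`fermatEigenspace_zero_le_range_map_hypersurfaceι`, transported back by `transportFun_map_fiberι`), again GIC-free.

## References

* [Shioda1979HodgeFermat] T. Shioda, The Hodge conjecture for Fermat varieties, Math. Ann. 245 (1979), §1.
* [Katz2009] N. M. Katz, Another look at the Dwork family, Progr. Math. 269 (2009), §3.
* [VoisinHodgeII2003] C. Voisin, Hodge Theory and Complex Algebraic Geometry II, CUP 2003, §3.1.2, Thm. 4.24.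
* [CarlsonMullerStachPeters2017] J. Carlson, S. Müller-Stach, C. Peters, Period Mappings and Period Domains (2017),
  Lemma–Definition 15.3.7.
-/

noncomputable section

open CategoryTheory AlgebraicGeometry MvPolynomial
open Literature.AlgebraicTopology.SingularHomology
open Literature.AlgebraicGeometry.Motives
open Literature.AlgebraicGeometry.Motives.UniversalHypersurface

namespace Literature.AlgebraicGeometry.HodgeTheory

/-! ### §1 Invariants transport along paths -/

/-- **Monodromy invariants are transported to monodromy invariants**: if `T` is the rational transport along a path
class `γ` from `s` to `t` and `x ∈ Hᵏ(X_s; ℚ)` is fixed by `Γ_s`, then `T x` is fixed by `Γ_t` (`Γ_t = T Γ_s T⁻¹`).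
[cite: VoisinHodgeII2003, §3.1.2] [cite: CarlsonMullerStachPeters2017, Lemma–Definition 15.3.7] -/
theorem forall_apply_eq_of_isRatTransport {𝒳 S : SchemeOver ℂ} (f : 𝒳 ⟶ S) (k : ℕ) {U : Set (ComplexPoints S)}
    (hU : IsCohomologicallyLocallyTrivialOn f U) {s t : U} {γ : Path.Homotopic.Quotient s t}
    {T : bettiCohomology (fiberOver f s.1) k ≃ₗ[ℚ] bettiCohomology (fiberOver f t.1) k}
    (hT : IsRatTransport f k hU γ T) (x : bettiCohomology (fiberOver f s.1) k)
    (hx : ∀ g ∈ ratMonodromyGroup f k hU s, g x = x) :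
    ∀ g ∈ ratMonodromyGroup f k hU t, g (T x) = T x := by
  rintro g ⟨δ, hδ⟩
  have hmem : (T ≪≫ₗ g) ≪≫ₗ T.symm ∈ ratMonodromyGroup f k hU s :=
    ⟨(γ.trans δ).trans γ.symm, (hT.trans f k hU hδ).trans f k hU (hT.symm f k hU)⟩
  have h := hx _ hmem
  rw [LinearEquiv.trans_apply, LinearEquiv.trans_apply, LinearEquiv.symm_apply_eq] at h
  exact h

namespace UniversalHypersurface

/-! ### §2 The Fermat point of a base-point-free monomial family -/

/-- **The Fermat form `Σ xᵢᵈ` is supported on every base-point-free `M`.** [cite: Shioda1979HodgeFermat, §1] -/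
theorem isSupportedOn_fermatPolynomial_of_isBasePointFree {n d : ℕ} {M : Set (DegIndex n d)}
    (hM : IsBasePointFree n d M) : IsSupportedOn n d M (fermatPolynomial ℂ n d) := by
  intro m hm
  rw [fermatPolynomial, coeff_sum]
  refine Finset.sum_eq_zero fun i _ => ?_
  rw [coeff_X_pow, if_neg]
  intro h
  apply hm
  have : m = ⟨Finsupp.single i d, by simp [Finsupp.degree_single]⟩ := Subtype.ext h.symm
  rw [this]
  exact hM i

/-- The Fermat form of degree `d ≥ 1` is nonsingular over `ℂ`. [cite: Shioda1979HodgeFermat, §1] -/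
theorem isNonsingularForm_fermatPolynomial {n d : ℕ} (hd : 1 ≤ d) :
    SmoothHypersurface.IsNonsingularForm ℂ (fermatPolynomial ℂ n d) :=
  SmoothHypersurface.isNonsingularForm_sum_X_pow (Nat.cast_ne_zero.mpr (by omega))

/-! ### §3 No invariants in the middle cohomology of an odd-dimensional base-point-free monomial family -/

/-- **Odd-dimensional monodromy invariants of a base-point-free monomial family vanish, unconditionally**: for `M`
base-point free of degree `d ≥ 1` in `x₀, …, x_{2p+2}`, every class of `H²ᵖ⁺¹(Y_t; ℚ)` fixed by the rational
monodromy group `Γ_t` of `π_M` is zero — transport to the Fermat point, the torus trick (every `a ∈ μ_d^{2p+3}` acts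
as a monodromy transformation), and `V(0) = 0` in odd degree. GIC-free replacement of the tree's
`familyM_ratInvariant_eq_zero_of_odd` in the middle degree. [cite: Shioda1979HodgeFermat, §1 (1.3)–(1.4)]
[cite: Katz2009, §3] [cite: VoisinHodgeII2003, §3.1.2] -/
theorem familyM_ratInvariant_eq_zero_of_fermat {p d : ℕ} {M : Set (DegIndex (2 * p + 1) d)}
    (hM : IsBasePointFree (2 * p + 1) d M) (hd : 1 ≤ d)
    (hU : IsCohomologicallyLocallyTrivialOn (familyM ℂ (2 * p + 1) d M) Set.univ)
    (t : ComplexPoints (baseM ℂ (2 * p + 1) d M))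
    (x : bettiCohomology (fiberOver (familyM ℂ (2 * p + 1) d M) t) (2 * p + 1))
    (hx : ∀ g ∈ ratMonodromyGroup (familyM ℂ (2 * p + 1) d M) (2 * p + 1) hU ⟨t, Set.mem_univ t⟩, g x = x) :
    x = 0 := by
  have hn : 1 ≤ 2 * p + 1 := by omega
  haveI : NeZero d := ⟨by omega⟩
  have hF : (fermatPolynomial ℂ (2 * p + 1) d).IsHomogeneous d := isHomogeneous_fermatPolynomial _ d
  have hJ : SmoothHypersurface.IsNonsingularForm ℂ (fermatPolynomial ℂ (2 * p + 1) d) :=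
    isNonsingularForm_fermatPolynomial hd
  have hMF : IsSupportedOn (2 * p + 1) d M (fermatPolynomial ℂ (2 * p + 1) d) :=
    isSupportedOn_fermatPolynomial_of_isBasePointFree hM
  -- transport to the Fermat point `t₀`
  haveI := pathConnectedSpace_complexPoints_baseM (2 * p + 1) d M t
  obtain ⟨T, hT⟩ := exists_ratTransport (familyM ℂ (2 * p + 1) d M) (2 * p + 1) hU
    (fun _ _ γ _ hα => isRationalClass_transportFun_familyM _ d M hn hd _ hU γ hα)
    (s := ⟨t, Set.mem_univ t⟩) (t := ⟨pointOfFormM ℂ (2 * p + 1) d M hF hJ hMF, Set.mem_univ _⟩)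
    ⟦(PathConnectedSpace.somePath t (pointOfFormM ℂ (2 * p + 1) d M hF hJ hMF)).map
      (continuous_id.subtype_mk fun y => Set.mem_univ y)⟧
  have hy := forall_apply_eq_of_isRatTransport (familyM ℂ (2 * p + 1) d M) (2 * p + 1) hU hT x hx
  -- the torus trick: the Fermat group acts by monodromy transformations
  obtain ⟨e, he⟩ := DiagonalTorus.exists_compatible_iso_familyM M hF hJ hd hMF
  have hz : ∀ a : fermatGroup (2 * p + 1) d,
      BettiUniverse.pull (diagonalAut _ (fermatGroup_le_diagonalStabilizer d a.2)) (2 * p + 1)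
        (BettiUniverse.pullEquiv e (2 * p + 1) (T x)) = BettiUniverse.pullEquiv e (2 * p + 1) (T x) := by
    intro a
    have hmem := DiagonalTorus.diagonalAut_conj_mem_ratMonodromyGroup_familyM M hF hJ hn hd hMF
      (fermatGroup_le_diagonalStabilizer d a.2) (2 * p + 1) hU e he
    have h := hy _ hmem
    rw [LinearEquiv.trans_apply, LinearEquiv.trans_apply, LinearEquiv.symm_apply_eq] at h
    exact h
  -- complexify: the class lies in the eigenspace of the trivial character, which is `⊥` in odd degree
  have hnat : ∀ {X Y : SchemeOver ℂ} (g : X ⟶ Y) (w : bettiCohomology Y (2 * p + 1)),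
      ofRatClass _ (2 * p + 1) (BettiUniverse.pull g (2 * p + 1) w) =
        complexBetti.map g (2 * p + 1) (ofRatClass _ (2 * p + 1) w) := fun g w =>
    ofRatClass_map (2 * p + 1) (AlgPoints.mapContinuous (L := ℂ) g) w
  have hc : ofRatClass _ (2 * p + 1) (BettiUniverse.pullEquiv e (2 * p + 1) (T x)) ∈
      fermatEigenspace d (0 : Fin (2 * p + 1 + 2) → ZMod d) (2 * p + 1) := by
    rw [mem_fermatEigenspace_iff]
    intro a
    have h1 : ((fermatCharacter d (0 : Fin (2 * p + 1 + 2) → ZMod d) a : ℂˣ) : ℂ) = 1 := by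
      rw [fermatCharacter_apply]
      simp only [Pi.zero_apply, ZMod.val_zero, pow_zero, Finset.prod_const_one, Units.val_one]
    rw [h1, one_smul]
    have h := congrArg (ofRatClass _ (2 * p + 1)) (hz a)
    rw [hnat] at h
    exact h
  rw [fermatEigenspace_eq_bot_odd_of_apply_eq_zero hd p (β := (0 : Fin (2 * p + 1 + 2) → ZMod d))
    (i := 0) rfl, Submodule.mem_bot] at hc
  have hz0 : BettiUniverse.pullEquiv e (2 * p + 1) (T x) = 0 :=
    ofRatClass_injective (2 * p + 1) (by rw [hc, map_zero])
  have hTx : T x = 0 := (BettiUniverse.pullEquiv e (2 * p + 1)).injective (by rw [hz0, map_zero])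
  exact T.injective (by rw [hTx, map_zero])


/-! ### §4 Even dimension: middle-degree invariants are ambient classes -/

/-- **Even-dimensional middle-degree monodromy invariants of a base-point-free monomial family come from `ℙⁿ⁺¹`,
unconditionally**: for `M` base-point free of degree `d ≥ 1` in `x₀, …, x_{2r+1}` (`r ≥ 1`), the complexification of
every class of `H²ʳ(Y_t; ℚ)` fixed by the rational monodromy group `Γ_t` of `π_M` is the restriction of a class of
`H²ʳ(ℙ²ʳ⁺¹(ℂ); ℂ)` along `Y_t → 𝒴_M → 𝒴_U → ℙ²ʳ⁺¹` (so the invariants are spanned by `hʳ|_{Y_t}`) — transport to the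
Fermat point, the torus trick (every `a ∈ μ_d^{2r+2}` acts as a monodromy transformation), `V(0) ⊆ ι^* H²ʳ(ℙ²ʳ⁺¹)`
(`fermatEigenspace_zero_le_range_map_hypersurfaceι`), and flatness of restricted global classes
(`transportFun_map_fiberι`). GIC-free replacement of the tree's `familyM_ofRatClass_ratInvariant_mem_range_projectiveSpace`
in the middle degree (Voisin II Thm. 4.24 / Cor. 4.25 for this family). [cite: Shioda1979HodgeFermat, §1 (1.3)–(1.4)]
[cite: Katz2009, §3] [cite: VoisinHodgeII2003, §3.1.2] -/
theorem familyM_ofRatClass_ratInvariant_mem_range_of_fermat_even {r d : ℕ} {M : Set (DegIndex (2 * r) d)}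
    (hM : IsBasePointFree (2 * r) d M) (hr : 1 ≤ r) (hd : 1 ≤ d)
    (hU : IsCohomologicallyLocallyTrivialOn (familyM ℂ (2 * r) d M) Set.univ)
    (t : ComplexPoints (baseM ℂ (2 * r) d M))
    (x : bettiCohomology (fiberOver (familyM ℂ (2 * r) d M) t) (2 * r))
    (hx : ∀ g ∈ ratMonodromyGroup (familyM ℂ (2 * r) d M) (2 * r) hU ⟨t, Set.mem_univ t⟩, g x = x) :
    ∃ η : complexBetti (projectiveSpace (2 * r + 1) ℂ) (2 * r),
      ofRatClass _ (2 * r) x = complexBetti.map (fiberToProjectiveSpace ℂ (2 * r) d M t) (2 * r) η := by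
  have hn : 1 ≤ 2 * r := by omega
  haveI : NeZero d := ⟨by omega⟩
  have hF : (fermatPolynomial ℂ (2 * r) d).IsHomogeneous d := isHomogeneous_fermatPolynomial _ d
  have hJ : SmoothHypersurface.IsNonsingularForm ℂ (fermatPolynomial ℂ (2 * r) d) :=
    isNonsingularForm_fermatPolynomial hd
  have hMF : IsSupportedOn (2 * r) d M (fermatPolynomial ℂ (2 * r) d) :=
    isSupportedOn_fermatPolynomial_of_isBasePointFree hM
  -- transport to the Fermat point `t₀`
  haveI := pathConnectedSpace_complexPoints_baseM (2 * r) d M t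
  set δ : Path.Homotopic.Quotient
      (⟨t, Set.mem_univ t⟩ : (Set.univ : Set (ComplexPoints (baseM ℂ (2 * r) d M))))
      ⟨pointOfFormM ℂ (2 * r) d M hF hJ hMF, Set.mem_univ _⟩ :=
    ⟦(PathConnectedSpace.somePath t (pointOfFormM ℂ (2 * r) d M hF hJ hMF)).map
      (continuous_id.subtype_mk fun y => Set.mem_univ y)⟧ with hδ
  obtain ⟨T, hT⟩ := exists_ratTransport (familyM ℂ (2 * r) d M) (2 * r) hU
    (fun _ _ γ _ hα => isRationalClass_transportFun_familyM _ d M hn hd _ hU γ hα) δ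
  have hy := forall_apply_eq_of_isRatTransport (familyM ℂ (2 * r) d M) (2 * r) hU hT x hx
  -- the torus trick: the Fermat group acts by monodromy transformations
  obtain ⟨e, he⟩ := DiagonalTorus.exists_compatible_iso_familyM M hF hJ hd hMF
  have hz : ∀ a : fermatGroup (2 * r) d,
      BettiUniverse.pull (diagonalAut _ (fermatGroup_le_diagonalStabilizer d a.2)) (2 * r)
        (BettiUniverse.pullEquiv e (2 * r) (T x)) = BettiUniverse.pullEquiv e (2 * r) (T x) := by
    intro a
    have hmem := DiagonalTorus.diagonalAut_conj_mem_ratMonodromyGroup_familyM M hF hJ hn hd hMF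
      (fermatGroup_le_diagonalStabilizer d a.2) (2 * r) hU e he
    have h := hy _ hmem
    rw [LinearEquiv.trans_apply, LinearEquiv.trans_apply, LinearEquiv.symm_apply_eq] at h
    exact h
  -- complexify: the class lies in `V(0) ⊆ ι^* H²ʳ(ℙ²ʳ⁺¹)`
  have hnat : ∀ {X Y : SchemeOver ℂ} (g : X ⟶ Y) (w : bettiCohomology Y (2 * r)),
      ofRatClass _ (2 * r) (BettiUniverse.pull g (2 * r) w) =
        complexBetti.map g (2 * r) (ofRatClass _ (2 * r) w) := fun g w =>
    ofRatClass_map (2 * r) (AlgPoints.mapContinuous (L := ℂ) g) w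
  have hc : ofRatClass _ (2 * r) (BettiUniverse.pullEquiv e (2 * r) (T x)) ∈
      fermatEigenspace d (0 : Fin (2 * r + 2) → ZMod d) (2 * r) := by
    rw [mem_fermatEigenspace_iff]
    intro a
    have h1 : ((fermatCharacter d (0 : Fin (2 * r + 2) → ZMod d) a : ℂˣ) : ℂ) = 1 := by
      rw [fermatCharacter_apply]
      simp only [Pi.zero_apply, ZMod.val_zero, pow_zero, Finset.prod_const_one, Units.val_one]
    rw [h1, one_smul]
    have h := congrArg (ofRatClass _ (2 * r)) (hz a)
    rw [hnat] at h
    exact h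
  obtain ⟨η, hη⟩ := fermatEigenspace_zero_le_range_map_hypersurfaceι hd hr hc
  refine ⟨η, ?_⟩
  -- read the class at the Fermat point through `e`, then transport back along `δ`
  have h0 : ofRatClass _ (2 * r) (T x) =
      complexBetti.map (fiberToProjectiveSpace ℂ (2 * r) d M (pointOfFormM ℂ (2 * r) d M hF hJ hMF)) (2 * r) η := by
    have h1 : ofRatClass _ (2 * r) (T x) = complexBetti.map e.hom (2 * r)
        (ofRatClass _ (2 * r) (BettiUniverse.pullEquiv e (2 * r) (T x))) := by
      rw [BettiUniverse.pullEquiv_apply, hnat, e.complexBetti_map_hom_map_inv]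
    rw [h1, ← hη, ← he, complexBetti.map_comp, ModuleCat.comp_apply]
  have h2 : transportFun (familyM ℂ (2 * r) d M) (2 * r) hU δ (ofRatClass _ (2 * r) x) =
      complexBetti.map (fiberι (familyM ℂ (2 * r) d M) (pointOfFormM ℂ (2 * r) d M hF hJ hMF)) (2 * r)
        (complexBetti.map (totalMToTotal ℂ (2 * r) d M ≫ UniversalHypersurface.toProjectiveSpace ℂ (2 * r) d) (2 * r) η) := by
    rw [← hT x, h0, complexBetti.map_comp, ModuleCat.comp_apply]
  have h3 := transportFun_symm_transportFun (familyM ℂ (2 * r) d M) (2 * r) hU δ (ofRatClass _ (2 * r) x)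
  rw [h2, transportFun_map_fiberι] at h3
  rw [← h3]
  change _ = complexBetti.map (fiberι (familyM ℂ (2 * r) d M) t ≫ totalMToTotal ℂ (2 * r) d M ≫
    UniversalHypersurface.toProjectiveSpace ℂ (2 * r) d) (2 * r) η
  simp only [complexBetti.map_comp, ModuleCat.comp_apply]

end UniversalHypersurface

end Literature.AlgebraicGeometry.HodgeTheory

end
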